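import Mathlib
import Literature.Analysis.FluidPDE.Tao2016AveragedNS.SelfSimilarCascadeBlowup
import Literature.Analysis.FluidPDE.Tao2016AveragedNS.ViscousSmoothingBootstrap
import HarnessLib

/-!
# The blow-up RATE of the exact cascade lattice is AT LEAST TYPE I in the critical amplitude, part 1/2
  (the critical quadratic estimate and the RICCATI COMPARISON):
  `sup_{i,k} Λ^k |X_{i,k}(t)| ≥ 1/(C₁ (T⋆ - t))` along the maximal exact flow of a robustly blowing-up
  table — NON-DEGENERACY of the self-similar renormalisation (support for the extraction stub
  `stub_eternalFromBlowup` of K2(1) `TaoLadderRungTwoBreak.BlowupRigidityOne`, stmt-NavierStokesRegularity-20206)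

MODEL lattice ODEs only (Tao 2016 §4 (4.12)); nothing here is a statement about the Navier–Stokes equations;
NO item is closed (`--supports stmt-NavierStokesRegularity-20206`). Route-independent; general `m`.

THE POINT. The extraction stub renormalises the blow-up as `W_n(σ) = Λ^n e^{-σ} X_n(T⋆ - e^{-σ})`, whose
sup-norm at log-time `σ` is `(T⋆ - t)·sup_k Λ^k ‖x_k(t)‖` (`…RenormalisedFlow.renormalisedFlow_norm`). The
UPPER bound of this quantity (type I) is open (N-39); this file proves the standard LOWER bound, so that no
ω-limit of the renormalised trajectory can be trivial in sup-norm: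

* `critical_mul_abs_quadTerm_le_sq` — the quadratic estimate in the CRITICAL weight:
  `Λ^n |quadTerm_{i,n}(X)| ≤ C₁ ℓ²` whenever `Λ^k|X_{j,k}| ≤ ℓ` on all shells, `C₁ = m² M_α (3 + Λ)`
  (`Λ = bigLam ε₀ = (1+ε₀)^{5/2}`, `Λ^k = (1+ε₀)^{5k/2}`; tree lemma `abs_quadTerm_le_of_bounds`);
* `critical_le_riccati` — RICCATI COMPARISON: for an exact flow on `[0,T)` (derivatives within `[0,∞)`,
  (4.5)-regular on every `[0,T']`, `T' < T`), if at time `s` all critical amplitudes are `≤ A` (`A > 0`)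
  and `C₂ > C₁`, `C₂ A (T - s) < 1`, then on `[s,T)` they stay below `A / (1 - C₂ A (T - s))` (comparison of
  the supremum `ℓ(t)` — Lipschitz on compact sub-intervals, right Dini derivative `≤ C₁ ℓ²` — with the
  solution of `B' = C₂ B²`, via `image_le_of_liminf_slope_right_lt_deriv_boundary'`);
* (sibling module `…CriticalRate`) `critical_rate_lower_bound` — hence if the critical amplitude is unbounded on `[0,T)` then at EVERY time
  `s < T` it is at least `1/(C₁(T-s))`: for every `L` with `L·C₁(T-s) < 1` some mode has
  `Λ^k|X_{i,k}(s)| > L`;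
* (sibling module `…CriticalRate`) `criticalRate_of_noGlobalCascade` — along the maximal exact flow of a robustly blowing-up `E₂(R)` table
  (`criticalBlowup_of_noGlobalCascade`): `sup_{i,k} Λ^k|X_{i,k}(t)| ≥ 1/(C₁(T⋆ - t))` on `[0,T⋆)`,
  `C₁ = m²(3 + Λ)`; equivalently the renormalised trajectory never enters the sup-norm ball of radius
  `1/C₁`.
-/

noncomputable section

-- the summit and its single sub-problem share the name (CONVENTIONS §1)
set_option linter.dupNamespace false

open Set Filter Topology

namespace Summit.NavierStokesRegularity.NavierStokesRegularity.Theorems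

namespace BlowupRigidityOne

open Literature.Analysis.FluidPDE Literature.Analysis.FluidPDE.TaoCascade

variable {m : ℕ}

/-! ### The quadratic estimate in the critical weight -/

/-- **Critical quadratic estimate.** Structure constants bounded by `M_α`, `ε₀ ≥ 0`. If at time `s` all
modes obey `(1+ε₀)^{5k/2}|X_{j,k}(s)| ≤ ℓ`, then `(1+ε₀)^{5n/2}|quadTerm_{i,n}(X)(s)| ≤ m² M_α (3 + Λ) ℓ²`
(`Λ = bigLam ε₀`): the three blocks of (4.8) at shells `n, n, n+1` and `n-1` contribute `ℓ²`, `2(Λ_n/Λ_{n+1})ℓ² ≤ 2ℓ²`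
and `(Λ_n/Λ_{n-1})ℓ² = Λℓ²`. [cite: Tao2016AveragedNS, §4 (4.8)] -/
theorem critical_mul_abs_quadTerm_le_sq {ε₀ Mα ℓ : ℝ} (hε : 0 ≤ ε₀) (hMα : 0 ≤ Mα) (hℓ : 0 ≤ ℓ)
    {α : Fin m → Fin m → Fin m → ℤ × ℤ × ℤ → ℝ} (hα : ∀ i₁ i₂ i₃ μ, |α i₁ i₂ i₃ μ| ≤ Mα)
    {X : Fin m → ℤ → ℝ → ℝ} {s : ℝ}
    (hL : ∀ (j : Fin m) (k : ℤ), (1 + ε₀) ^ ((5 : ℝ) * k / 2) * |X j k s| ≤ ℓ) (i : Fin m) (n : ℤ) :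
    (1 + ε₀) ^ ((5 : ℝ) * n / 2) * |quadTerm ε₀ α X i n s| ≤
      (m : ℝ) ^ 2 * Mα * (3 + bigLam ε₀) * ℓ ^ 2 := by
  have hl1 : (1 : ℝ) ≤ 1 + ε₀ := by linarith
  have hl0 : (0 : ℝ) < 1 + ε₀ := by linarith
  set P : ℤ → ℝ := fun k => (1 + ε₀) ^ ((5 : ℝ) * k / 2) with hPdef
  have hP : ∀ k, 0 < P k := fun k => Real.rpow_pos_of_pos hl0 _
  have hb : ∀ j k, |X j k s| ≤ ℓ / P k := fun j k => by
    rw [le_div_iff₀ (hP k), mul_comm]; exact hL j k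
  have hb0 : ∀ k, 0 ≤ ℓ / P k := fun k => div_nonneg hℓ (hP k).le
  have hq := abs_quadTerm_le_of_bounds hl0.le hMα hα X i n s (hb0 n) (hb0 (n - 1))
    (fun j => hb j (n - 1)) (fun j => hb j n) (fun j => hb j (n + 1))
  have hPn1 : (1 + ε₀) ^ ((5 : ℝ) * ((n : ℝ) - 1) / 2) = P (n - 1) := by
    simp only [hPdef, Int.cast_sub, Int.cast_one]
  have hPn : (1 + ε₀) ^ ((5 : ℝ) * n / 2) = P n := rfl
  rw [hPn1] at hq
  rw [hPn]
  -- the three gains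
  have hPmono : P n ≤ P (n + 1) := by
    simp only [hPdef]
    refine Real.rpow_le_rpow_of_exponent_le hl1 ?_
    push_cast; linarith
  have hPlam : P n = bigLam ε₀ * P (n - 1) := by
    simp only [hPdef, bigLam]
    rw [← Real.rpow_add hl0]; congr 1; push_cast; ring
  have hc1 : P n * (ℓ / P n) = ℓ := by rw [mul_div_assoc', mul_div_cancel_left₀ _ (hP n).ne']
  have hc2 : P (n - 1) * (ℓ / P (n - 1)) = ℓ := by
    rw [mul_div_assoc', mul_div_cancel_left₀ _ (hP (n - 1)).ne']
  have e1 : P n * (P n * (ℓ / P n * (ℓ / P n))) = ℓ ^ 2 := by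
    calc P n * (P n * (ℓ / P n * (ℓ / P n))) = (P n * (ℓ / P n)) * (P n * (ℓ / P n)) := by ring
      _ = ℓ ^ 2 := by rw [hc1]; ring
  have e2 : P n * (P n * (ℓ / P n * (ℓ / P (n + 1)))) ≤ ℓ ^ 2 := by
    have h1 : P n * (P n * (ℓ / P n * (ℓ / P (n + 1)))) = (P n / P (n + 1)) * ℓ ^ 2 := by
      calc P n * (P n * (ℓ / P n * (ℓ / P (n + 1)))) = (P n * (ℓ / P n)) * (ℓ * (P n / P (n + 1))) := by
            ring
        _ = (P n / P (n + 1)) * ℓ ^ 2 := by rw [hc1]; ring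
    rw [h1]
    have h2 : P n / P (n + 1) ≤ 1 := (div_le_one (hP (n + 1))).2 hPmono
    nlinarith [sq_nonneg ℓ]
  have e3 : P n * (P (n - 1) * (ℓ / P (n - 1) * (ℓ / P (n - 1)))) = bigLam ε₀ * ℓ ^ 2 := by
    calc P n * (P (n - 1) * (ℓ / P (n - 1) * (ℓ / P (n - 1))))
        = bigLam ε₀ * ((P (n - 1) * (ℓ / P (n - 1))) * (P (n - 1) * (ℓ / P (n - 1)))) := by
          rw [hPlam]; ring
      _ = bigLam ε₀ * ℓ ^ 2 := by rw [hc2]; ring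
  have hm2 : 0 ≤ (m : ℝ) ^ 2 * Mα := by positivity
  calc P n * |quadTerm ε₀ α X i n s|
      ≤ P n * ((m : ℝ) ^ 2 * Mα * (P n * (ℓ / P n * (ℓ / P n) + 2 * (ℓ / P n * (ℓ / P (n + 1)))) +
          P (n - 1) * (ℓ / P (n - 1) * (ℓ / P (n - 1))))) := mul_le_mul_of_nonneg_left hq (hP n).le
    _ = (m : ℝ) ^ 2 * Mα * (P n * (P n * (ℓ / P n * (ℓ / P n))) +
          2 * (P n * (P n * (ℓ / P n * (ℓ / P (n + 1))))) +
          P n * (P (n - 1) * (ℓ / P (n - 1) * (ℓ / P (n - 1))))) := by ring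
    _ ≤ (m : ℝ) ^ 2 * Mα * (ℓ ^ 2 + 2 * ℓ ^ 2 + bigLam ε₀ * ℓ ^ 2) := by
        rw [e1, e3]
        exact mul_le_mul_of_nonneg_left (by linarith [e2]) hm2
    _ = (m : ℝ) ^ 2 * Mα * (3 + bigLam ε₀) * ℓ ^ 2 := by ring

/-! ### Riccati comparison for the critical supremum -/

/-- **RICCATI COMPARISON.** Structure constants bounded by `M_α`, `ε₀ ≥ 0`, `C₁ = m² M_α (3 + Λ)`. Let `X`
solve the exact lattice on `[0,T)` (derivatives within `[0,∞)`) and be (4.5)-regular on every `[0,T']`,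
`T' < T`. If at a time `s ∈ [0,T)` every critical amplitude satisfies `(1+ε₀)^{5k/2}|X_{i,k}(s)| ≤ A`
(`A > 0`), and `C₂ > C₁`, `C₂ A (T - s) < 1`, then for all `t ∈ [s,T)`:
`(1+ε₀)^{5k/2}|X_{i,k}(t)| ≤ A / (1 - C₂ A (T - s))`. (The supremum `ℓ(t)` over the modes is Lipschitz on
compact sub-intervals, has right Dini derivative `≤ C₁ℓ(t)²`, and is compared with the solution
`B(t) = A/(1 - C₂A(t-s))` of `B' = C₂B²`, `B(s) = A`.)
[cite: Teschl2012, §2.6 (maximal solutions, blow-up rate); Tao2016AveragedNS, §4 (4.8), (4.12)] -/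
theorem critical_le_riccati {ε₀ Mα T : ℝ} (hε : 0 ≤ ε₀) (hMα : 0 ≤ Mα)
    {α : Fin m → Fin m → Fin m → ℤ × ℤ × ℤ → ℝ} (hα : ∀ i₁ i₂ i₃ μ, |α i₁ i₂ i₃ μ| ≤ Mα)
    {X : Fin m → ℤ → ℝ → ℝ}
    (hder : ∀ i k, ∀ t ∈ Ico 0 T, HasDerivWithinAt (X i k) (quadTerm ε₀ α X i k t) (Ici 0) t)
    (hreg : ∀ T' : ℝ, T' < T → ∃ M : ℝ, ∀ t ∈ Icc 0 T', ∀ (i : Fin m) (k : ℤ),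
      (1 + (1 + ε₀) ^ ((10 : ℝ) * k)) * |X i k t| ≤ M)
    {s A C₂ : ℝ} (hs : s ∈ Ico 0 T) (hA : 0 < A)
    (hAs : ∀ (i : Fin m) (k : ℤ), (1 + ε₀) ^ ((5 : ℝ) * k / 2) * |X i k s| ≤ A)
    (hC₂ : (m : ℝ) ^ 2 * Mα * (3 + bigLam ε₀) < C₂) (hgap : C₂ * A * (T - s) < 1) :
    ∀ t ∈ Ico s T, ∀ (i : Fin m) (k : ℤ),
      (1 + ε₀) ^ ((5 : ℝ) * k / 2) * |X i k t| ≤ A / (1 - C₂ * A * (T - s)) := by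
  rcases isEmpty_or_nonempty (Fin m) with hm | hm
  · exact fun t _ i => (hm.false i).elim
  intro t ht i k
  set C₁ : ℝ := (m : ℝ) ^ 2 * Mα * (3 + bigLam ε₀) with hC₁def
  have hl0 : (0 : ℝ) < 1 + ε₀ := by linarith
  have hl1 : (1 : ℝ) ≤ 1 + ε₀ := by linarith
  have hLam : 0 < bigLam ε₀ := bigLam_pos (by linarith)
  have hC₁0 : 0 ≤ C₁ := by positivity
  have hC₂0 : 0 < C₂ := lt_of_le_of_lt hC₁0 hC₂
  set P : ℤ → ℝ := fun k => (1 + ε₀) ^ ((5 : ℝ) * k / 2) with hPdef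
  have hP0 : ∀ k, 0 < P k := fun k => Real.rpow_pos_of_pos hl0 _
  have hPabs : ∀ j k τ, P k * |X j k τ| = |P k * X j k τ| := fun j k τ => by
    rw [abs_mul, abs_of_pos (hP0 k)]
  -- the critical weight is dominated by the (4.5) weight
  have hPW : ∀ k : ℤ, P k ≤ 1 + (1 + ε₀) ^ ((10 : ℝ) * k) := by
    intro k
    rcases le_or_gt 0 k with hk | hk
    · have : P k ≤ (1 + ε₀) ^ ((10 : ℝ) * k) := by
        simp only [hPdef]
        refine Real.rpow_le_rpow_of_exponent_le hl1 ?_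
        have : (0 : ℝ) ≤ k := by exact_mod_cast hk
        linarith
      linarith
    · have : P k ≤ 1 := by
        simp only [hPdef]
        refine Real.rpow_le_one_of_one_le_of_nonpos hl1 ?_
        have : (k : ℝ) ≤ 0 := by exact_mod_cast hk.le
        linarith
      linarith [Real.rpow_nonneg hl0.le ((10 : ℝ) * k)]
  -- work on `[0, T']`, `T' := t`
  obtain ⟨M', hM'⟩ := hreg t ht.2
  set ℓ : ℝ → ℝ := fun τ => ⨆ p : Fin m × ℤ, P p.2 * |X p.1 p.2 τ| with hℓdef
  have hbdd : ∀ τ ∈ Icc (0 : ℝ) t, BddAbove (Set.range fun p : Fin m × ℤ => P p.2 * |X p.1 p.2 τ|) :=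
    fun τ hτ => ⟨M', by
      rintro _ ⟨p, rfl⟩
      exact (mul_le_mul_of_nonneg_right (hPW p.2) (abs_nonneg _)).trans (hM' τ hτ p.1 p.2)⟩
  have hleℓ : ∀ τ ∈ Icc (0 : ℝ) t, ∀ (j : Fin m) (k : ℤ), P k * |X j k τ| ≤ ℓ τ :=
    fun τ hτ j k => le_ciSup (hbdd τ hτ) (j, k)
  have hℓle : ∀ τ ∈ Icc (0 : ℝ) t, ℓ τ ≤ M' := fun τ hτ => ciSup_le fun p =>
    (mul_le_mul_of_nonneg_right (hPW p.2) (abs_nonneg _)).trans (hM' τ hτ p.1 p.2)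
  have hℓ0 : ∀ τ ∈ Icc (0 : ℝ) t, 0 ≤ ℓ τ := fun τ hτ =>
    le_trans (mul_nonneg (hP0 0).le (abs_nonneg (X (Classical.arbitrary (Fin m)) 0 τ))) (hleℓ τ hτ _ 0)
  -- the quadratic derivative bound along the flow
  have hqℓ : ∀ τ ∈ Icc (0 : ℝ) t, ∀ (j : Fin m) (k : ℤ),
      P k * |quadTerm ε₀ α X j k τ| ≤ C₁ * ℓ τ ^ 2 := fun τ hτ j k =>
    critical_mul_abs_quadTerm_le_sq hε hMα (hℓ0 τ hτ) hα (fun j' k' => hleℓ τ hτ j' k') j k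
  -- mean value on `[a,b] ⊆ [0,t]`
  have hMVT : ∀ a b C : ℝ, 0 ≤ a → a ≤ b → b ≤ t →
      (∀ τ ∈ Ico a b, ∀ (j : Fin m) (k : ℤ), P k * |quadTerm ε₀ α X j k τ| ≤ C) →
      ∀ (j : Fin m) (k : ℤ), |P k * X j k b - P k * X j k a| ≤ C * (b - a) := by
    intro a b C ha hab hbt hC j k
    have hd : ∀ τ ∈ Icc a b, HasDerivWithinAt (fun τ => P k * X j k τ)
        (P k * quadTerm ε₀ α X j k τ) (Icc a b) τ := by
      intro τ hτ
      exact ((hder j k τ ⟨ha.trans hτ.1, lt_of_le_of_lt (hτ.2.trans hbt) ht.2⟩).mono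
        (fun x hx => ha.trans hx.1)).const_mul (P k)
    have key := norm_image_sub_le_of_norm_deriv_le_segment' hd (fun τ hτ => by
      rw [Real.norm_eq_abs, abs_mul, abs_of_pos (hP0 k)]; exact hC τ hτ j k) b (right_mem_Icc.2 hab)
    simpa only [Real.norm_eq_abs] using key
  -- `ℓ` is Lipschitz on `[0,t]` with constant `C₁ M'²`
  have hℓlip : ∀ a b : ℝ, 0 ≤ a → a ≤ b → b ≤ t → |ℓ b - ℓ a| ≤ C₁ * M' ^ 2 * (b - a) := by
    intro a b ha hab hbt
    have ha' : a ∈ Icc (0 : ℝ) t := ⟨ha, hab.trans hbt⟩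
    have hb' : b ∈ Icc (0 : ℝ) t := ⟨ha.trans hab, hbt⟩
    have hcomp := hMVT a b (C₁ * M' ^ 2) ha hab hbt (fun τ hτ j k => by
      have hτ' : τ ∈ Icc (0 : ℝ) t := ⟨ha.trans hτ.1, hτ.2.le.trans hbt⟩
      refine (hqℓ τ hτ' j k).trans (mul_le_mul_of_nonneg_left ?_ hC₁0)
      exact pow_le_pow_left₀ (hℓ0 τ hτ') (hℓle τ hτ') 2)
    rw [abs_le]
    constructor
    · have : ℓ a ≤ ℓ b + C₁ * M' ^ 2 * (b - a) := ciSup_le fun p => by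
        have h1 := hcomp p.1 p.2
        have h2 := hleℓ b hb' p.1 p.2
        rw [hPabs] at h2 ⊢
        linarith [abs_sub_abs_le_abs_sub (P p.2 * X p.1 p.2 a) (P p.2 * X p.1 p.2 b),
          abs_sub_comm (P p.2 * X p.1 p.2 a) (P p.2 * X p.1 p.2 b)]
      linarith
    · have : ℓ b ≤ ℓ a + C₁ * M' ^ 2 * (b - a) := ciSup_le fun p => by
        have h1 := hcomp p.1 p.2
        have h2 := hleℓ a ha' p.1 p.2
        rw [hPabs] at h2 ⊢
        linarith [abs_sub_abs_le_abs_sub (P p.2 * X p.1 p.2 b) (P p.2 * X p.1 p.2 a)]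
      linarith
  have hℓlip' : ∀ a ∈ Icc (0 : ℝ) t, ∀ b ∈ Icc (0 : ℝ) t, |ℓ a - ℓ b| ≤ C₁ * M' ^ 2 * |a - b| := by
    intro a ha b hb
    rcases le_total a b with hab | hba
    · rw [abs_sub_comm, abs_of_nonpos (by linarith : a - b ≤ 0), neg_sub]
      exact hℓlip a b ha.1 hab hb.2
    · rw [abs_of_nonneg (by linarith : 0 ≤ a - b)]
      exact hℓlip b a hb.1 hba ha.2
  have hℓcont : ContinuousOn ℓ (Icc 0 t) := by
    rw [Metric.continuousOn_iff]
    intro b hb ε hεp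
    have hK : 0 ≤ C₁ * M' ^ 2 := by positivity
    refine ⟨ε / (C₁ * M' ^ 2 + 1), div_pos hεp (by linarith), fun a ha hab => ?_⟩
    rw [Real.dist_eq] at hab ⊢
    calc |ℓ a - ℓ b| ≤ C₁ * M' ^ 2 * |a - b| := hℓlip' a ha b hb
      _ ≤ (C₁ * M' ^ 2 + 1) * |a - b| := mul_le_mul_of_nonneg_right (by linarith) (abs_nonneg _)
      _ < (C₁ * M' ^ 2 + 1) * (ε / (C₁ * M' ^ 2 + 1)) := mul_lt_mul_of_pos_left hab (by linarith)
      _ = ε := by field_simp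
  -- right Dini derivative of `ℓ` is at most `C₁ ℓ²`
  have hDini : ∀ x ∈ Ico s t, ∀ r : ℝ, C₁ * ℓ x ^ 2 < r →
      ∃ᶠ z in 𝓝[>] x, slope ℓ x z < r := by
    intro x hx r hr
    have hx0 : 0 ≤ x := hs.1.trans hx.1
    have hxt' : x ∈ Icc (0 : ℝ) t := ⟨hx0, hx.2.le⟩
    set r' : ℝ := (C₁ * ℓ x ^ 2 + r) / 2 with hr'def
    have hr'1 : C₁ * ℓ x ^ 2 < r' := by rw [hr'def]; linarith
    have hr'2 : r' < r := by rw [hr'def]; linarith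
    -- an `η > 0` with `C₁ (ℓ x + η)² < r'`
    have hηev : ∀ᶠ η in 𝓝[>] (0 : ℝ), C₁ * (ℓ x + η) ^ 2 < r' := by
      have hc : ContinuousAt (fun η : ℝ => C₁ * (ℓ x + η) ^ 2) 0 := by fun_prop
      have hlim : Tendsto (fun η : ℝ => C₁ * (ℓ x + η) ^ 2) (𝓝[>] 0) (𝓝 (C₁ * (ℓ x + 0) ^ 2)) :=
        hc.tendsto.mono_left nhdsWithin_le_nhds
      exact hlim (Iio_mem_nhds (by simpa using hr'1))
    obtain ⟨η, hηr, hη⟩ := (hηev.and self_mem_nhdsWithin).exists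
    have hη : 0 < η := hη
    have hcx : ContinuousWithinAt ℓ (Icc 0 t) x := hℓcont x hxt'
    rw [Metric.continuousWithinAt_iff] at hcx
    obtain ⟨δ, hδ, hδℓ⟩ := hcx η hη
    have hev : ∀ᶠ z in 𝓝[>] x, z ∈ Ioo x (min t (x + δ)) :=
      Ioo_mem_nhdsGT (lt_min hx.2 (by linarith))
    refine (hev.mono fun z hz => ?_).frequently
    obtain ⟨hxz, hz⟩ := hz
    have hzt : z ≤ t := (lt_of_lt_of_le hz (min_le_left _ _)).le
    have hC : ∀ τ ∈ Ico x z, ∀ (j : Fin m) (k : ℤ), P k * |quadTerm ε₀ α X j k τ| ≤ r' := by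
      intro τ hτ j k
      have hτt : τ ∈ Icc (0 : ℝ) t := ⟨hx0.trans hτ.1, hτ.2.le.trans hzt⟩
      have hdist : dist τ x < δ := by
        rw [Real.dist_eq, abs_of_nonneg (by linarith [hτ.1])]
        linarith [hτ.2, lt_of_lt_of_le hz (min_le_right _ _)]
      have hℓτ : ℓ τ < ℓ x + η := by
        have h := hδℓ hτt hdist
        rw [Real.dist_eq] at h
        linarith [(abs_lt.1 h).2]
      calc P k * |quadTerm ε₀ α X j k τ| ≤ C₁ * ℓ τ ^ 2 := hqℓ τ hτt j k
        _ ≤ C₁ * (ℓ x + η) ^ 2 :=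
            mul_le_mul_of_nonneg_left (pow_le_pow_left₀ (hℓ0 τ hτt) hℓτ.le 2) hC₁0
        _ ≤ r' := hηr.le
    have hcompz := hMVT x z r' hx0 hxz.le hzt hC
    have hℓz : ℓ z ≤ ℓ x + r' * (z - x) := ciSup_le fun p => by
      have h1 := hcompz p.1 p.2
      have h2 := hleℓ x hxt' p.1 p.2
      rw [hPabs] at h2 ⊢
      linarith [abs_sub_abs_le_abs_sub (P p.2 * X p.1 p.2 z) (P p.2 * X p.1 p.2 x)]
    have hzx : 0 < z - x := sub_pos.2 hxz
    rw [slope_def_field]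
    calc (ℓ z - ℓ x) / (z - x) ≤ r' * (z - x) / (z - x) :=
          div_le_div_of_nonneg_right (by linarith) hzx.le
      _ = r' := by field_simp
      _ < r := hr'2
  -- the Riccati supersolution `B(τ) = A / (1 - C₂ A (τ - s))`
  set g : ℝ → ℝ := fun τ => 1 - C₂ * A * (τ - s) with hgdef
  set B : ℝ → ℝ := fun τ => A / g τ with hBdef
  have hgpos : ∀ τ, τ ≤ t → 0 < g τ := fun τ hτ => by
    simp only [hgdef]
    have : C₂ * A * (τ - s) ≤ C₂ * A * (T - s) :=
      mul_le_mul_of_nonneg_left (by linarith [ht.2]) (mul_pos hC₂0 hA).le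
    linarith
  have hgle : ∀ τ, s ≤ τ → g τ ≤ 1 := fun τ hτ => by
    simp only [hgdef]
    nlinarith [mul_pos hC₂0 hA]
  have hBder : ∀ τ ∈ Ico s t, HasDerivWithinAt B (C₂ * B τ ^ 2) (Ici τ) τ := by
    intro τ hτ
    have hg' : HasDerivAt g (-(C₂ * A)) τ := by
      have h := ((hasDerivAt_id τ).sub_const s).const_mul (C₂ * A)
      have h2 := h.const_sub 1
      rw [mul_one] at h2
      exact h2
    have hgτ : g τ ≠ 0 := (hgpos τ hτ.2.le).ne'
    have hB' : HasDerivAt B ((0 * g τ - A * -(C₂ * A)) / g τ ^ 2) τ :=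
      (hasDerivAt_const τ A).div hg' hgτ
    refine (hB'.hasDerivWithinAt).congr_deriv ?_
    have hnum : (0 * g τ - A * -(C₂ * A)) = C₂ * A ^ 2 := by ring
    rw [hnum]
    show C₂ * A ^ 2 / g τ ^ 2 = C₂ * (A / g τ) ^ 2
    rw [div_pow, mul_div_assoc]
  have hBcont : ContinuousOn B (Icc s t) := by
    refine ContinuousOn.div continuousOn_const ?_ fun τ hτ => (hgpos τ hτ.2).ne'
    simp only [hgdef]; fun_prop
  have hℓcont' : ContinuousOn ℓ (Icc s t) := hℓcont.mono (Icc_subset_Icc hs.1 le_rfl)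
  have hℓs : ℓ s ≤ B s := by
    have : B s = A := by simp [hBdef, hgdef]
    rw [this]
    exact ciSup_le fun p => hAs p.1 p.2
  have hbound : ∀ x ∈ Ico s t, ℓ x = B x → C₁ * ℓ x ^ 2 < C₂ * B x ^ 2 := by
    intro x hx hxB
    rw [hxB]
    have hBpos : 0 < B x := div_pos hA (hgpos x hx.2.le)
    exact mul_lt_mul_of_pos_right hC₂ (pow_pos hBpos 2)
  have hcmp := image_le_of_liminf_slope_right_lt_deriv_boundary' (f := ℓ) (f' := fun x => C₁ * ℓ x ^ 2)
    hℓcont' hDini hℓs hBcont hBder hbound (right_mem_Icc.2 ht.1)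
  -- conclude at time `t`
  have hBt : B t ≤ A / (1 - C₂ * A * (T - s)) := by
    have hgT : 0 < 1 - C₂ * A * (T - s) := by linarith
    have hle : 1 - C₂ * A * (T - s) ≤ g t := by
      simp only [hgdef]
      have : C₂ * A * (t - s) ≤ C₂ * A * (T - s) :=
        mul_le_mul_of_nonneg_left (by linarith [ht.2]) (mul_pos hC₂0 hA).le
      linarith
    exact div_le_div_of_nonneg_left hA.le hgT hle
  calc (1 + ε₀) ^ ((5 : ℝ) * k / 2) * |X i k t| = P k * |X i k t| := rfl
    _ ≤ ℓ t := hleℓ t ⟨hs.1.trans ht.1, le_rfl⟩ i k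
    _ ≤ B t := hcmp
    _ ≤ A / (1 - C₂ * A * (T - s)) := hBt

end BlowupRigidityOne

end Summit.NavierStokesRegularity.NavierStokesRegularity.Theorems

end
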